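import Summits.NavierStokesRegularity.NavierStokesRegularity.Theorems.TerminalTraceTypeITraceScarL3StripRepresentative
import Literature.Analysis.FluidPDE.LocalTypeI
import HarnessLib

/-!
# An extinct Type-I apex is singular only AT THE TOP TIME: `Σ(U) ∩ {t ≤ 0} = {0} × Σ₀`
# (item `TerminalTrace.TypeITraceScarL3`, stmt-NavierStokesRegularity-18385; ROUND-26 §3a (S1), kernel)

Seat ns-typeII-p3 g10 (cell ns-regularity-ideate), `--supports stmt-NavierStokesRegularity-18385` (helper).
For a pair `(U, P)` suitable in every parabolic ball `Q(a)` at the origin with the Type-I rate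
`‖U(s, y)‖ ≤ C/√(−s)` (a.e. `y`, every `s < 0`), the rate bounds `U` essentially on every strip below a
negative time (`ae_norm_le_strip_of_rate`, p588275), so:

* `not_isBackwardSingularPoint_of_neg_time` — no point `(t, x)` with `t < 0` is backward singular;
* `backwardSingular_nonpos_iff` — a point `z` with `z.1 ≤ 0` is backward singular iff `z.1 = 0` and
  `z.2 ∈ Σ₀ := {x | (0, x) backward singular}`: the backward singular set below the top time is the top slice
  `{0} × Σ₀` (ROUND-26 §3a (S1); for `Σ₀` see `isClosed_topSingularSet`,
  `hausdorffMeasure_topSingular_apex_eq_zero`, `exists_topSingular_mem_shell_of_quietShellExclusion`).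

WHAT THIS IS NOT: not Stub QA / LOUD, not NS regularity — bookkeeping of the rate inside the apex class.
[folklore; Seregin2014 §6.6; AlbrittonBarker2019 §1]
-/

noncomputable section

set_option linter.dupNamespace false

namespace Summit.NavierStokesRegularity.NavierStokesRegularity.Theorems.TypeITraceScarL3

open MeasureTheory Set Function Filter Topology Metric
open Literature.Analysis.FluidPDE
open scoped NNReal ENNReal InnerProductSpace RealInnerProductSpace

/-- **No backward singular point strictly below the top time.**  If `(U, P)` is suitable in every `Q(a)`
at the origin and obeys the Type-I rate `‖U(s, y)‖ ≤ C/√(−s)`, then for every `t < 0` and every `x` the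
point `(t, x)` is NOT backward singular: on the strip `]t − r², t[ × ℝ³` the rate gives the essential bound
`|C|/√(−t)`, so `U ∈ L^∞(Q_r((t, x)))`. [folklore; Seregin2014 §6.6] -/
theorem not_isBackwardSingularPoint_of_neg_time
    {U : ℝ → EuclideanSpace ℝ (Fin 3) → EuclideanSpace ℝ (Fin 3)}
    {P : ℝ → EuclideanSpace ℝ (Fin 3) → ℝ} {C : ℝ}
    (hsw : ∀ a : ℝ, 0 < a →
      IsSuitableWeakSolutionInBall a (0 : ℝ × EuclideanSpace ℝ (Fin 3)) U P)
    (hrate : ∀ s : ℝ, s < 0 →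
      ∀ᵐ y : EuclideanSpace ℝ (Fin 3), ‖U s y‖ ≤ C / Real.sqrt (-s))
    {t : ℝ} (ht : t < 0) (x : EuclideanSpace ℝ (Fin 3)) :
    ¬ IsBackwardSingularPoint U (t, x) := by
  intro hsing
  -- the rate on the strip `]t - 1, t[ × ℝ³`
  have hstrip := ae_norm_le_strip_of_rate hsw hrate (a := t - 1 ^ 2) ht
  have hsub : parabolicCylinder 1 ((t, x) : ℝ × EuclideanSpace ℝ (Fin 3)) ⊆
      Ioo (t - 1 ^ 2) t ×ˢ (univ : Set (EuclideanSpace ℝ (Fin 3))) := by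
    rintro ⟨s, y⟩ hz
    rw [mem_parabolicCylinder] at hz
    exact ⟨hz.1, mem_univ _⟩
  have hbd : ∀ᵐ z ∂(volume.restrict (parabolicCylinder 1 ((t, x) : ℝ × EuclideanSpace ℝ (Fin 3)))),
      ‖uncurry U z‖ ≤ |C| / Real.sqrt (-t) := by
    filter_upwards [ae_restrict_of_ae_restrict_of_subset hsub hstrip] with z hz
    exact hz
  have hlt : eLpNorm (uncurry U) ∞
      (volume.restrict (parabolicCylinder 1 ((t, x) : ℝ × EuclideanSpace ℝ (Fin 3)))) < ∞ := by
    rw [eLpNorm_exponent_top]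
    exact eLpNormEssSup_lt_top_of_ae_bound hbd
  exact hlt.ne (hsing 1 one_pos)

/-- **The backward singular set below the top time is the top slice `{0} × Σ₀`** (ROUND-26 §3a (S1)): for a
pair suitable in every `Q(a)` at the origin with the Type-I rate, a space–time point `z` with `z.1 ≤ 0` is
backward singular iff `z.1 = 0` and `z.2` lies in the top singular set `Σ₀ = {x | (0, x) backward singular}`.
[folklore; Seregin2014 §6.6; AlbrittonBarker2019 §1] -/
theorem backwardSingular_nonpos_iff
    {U : ℝ → EuclideanSpace ℝ (Fin 3) → EuclideanSpace ℝ (Fin 3)}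
    {P : ℝ → EuclideanSpace ℝ (Fin 3) → ℝ} {C : ℝ}
    (hsw : ∀ a : ℝ, 0 < a →
      IsSuitableWeakSolutionInBall a (0 : ℝ × EuclideanSpace ℝ (Fin 3)) U P)
    (hrate : ∀ s : ℝ, s < 0 →
      ∀ᵐ y : EuclideanSpace ℝ (Fin 3), ‖U s y‖ ≤ C / Real.sqrt (-s))
    {z : ℝ × EuclideanSpace ℝ (Fin 3)} (hz : z.1 ≤ 0) :
    IsBackwardSingularPoint U z ↔
      z.1 = 0 ∧ z.2 ∈ {x : EuclideanSpace ℝ (Fin 3) | IsBackwardSingularPoint U ((0 : ℝ), x)} := by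
  constructor
  · intro hsing
    rcases hz.lt_or_eq with hlt | heq
    · exact absurd hsing (by
        have h := not_isBackwardSingularPoint_of_neg_time hsw hrate hlt z.2
        rwa [Prod.mk.eta] at h)
    · refine ⟨heq, ?_⟩
      have hz' : z = ((0 : ℝ), z.2) := by rw [← heq]
      rw [hz'] at hsing
      exact hsing
  · rintro ⟨heq, hsing⟩
    have hz' : z = ((0 : ℝ), z.2) := by rw [← heq]
    rw [hz']
    exact hsing

/-- **Hence the backward singular set below the top time is the image of `Σ₀` on the top slice.** [folklore] -/
theorem backwardSingularSet_nonpos_eq_image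
    {U : ℝ → EuclideanSpace ℝ (Fin 3) → EuclideanSpace ℝ (Fin 3)}
    {P : ℝ → EuclideanSpace ℝ (Fin 3) → ℝ} {C : ℝ}
    (hsw : ∀ a : ℝ, 0 < a →
      IsSuitableWeakSolutionInBall a (0 : ℝ × EuclideanSpace ℝ (Fin 3)) U P)
    (hrate : ∀ s : ℝ, s < 0 →
      ∀ᵐ y : EuclideanSpace ℝ (Fin 3), ‖U s y‖ ≤ C / Real.sqrt (-s)) :
    {z : ℝ × EuclideanSpace ℝ (Fin 3) | z.1 ≤ 0 ∧ IsBackwardSingularPoint U z} =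
      (fun x : EuclideanSpace ℝ (Fin 3) => (((0 : ℝ), x) : ℝ × EuclideanSpace ℝ (Fin 3))) ''
        {x : EuclideanSpace ℝ (Fin 3) | IsBackwardSingularPoint U ((0 : ℝ), x)} := by
  ext z
  constructor
  · rintro ⟨hz, hsing⟩
    obtain ⟨heq, hmem⟩ := (backwardSingular_nonpos_iff hsw hrate hz).1 hsing
    exact ⟨z.2, hmem, by rw [← heq]⟩
  · rintro ⟨x, hx, rfl⟩
    exact ⟨le_rfl, hx⟩

end Summit.NavierStokesRegularity.NavierStokesRegularity.Theorems.TypeITraceScarL3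

end
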